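import Summits.RiemannHypothesis.RiemannHypothesis.Theorems.Splittings.ScrewIndexTransferKrein
import Literature.NumberTheory.LFunctions.ZetaScrewLaplace
import Literature.NumberTheory.LFunctions.ZetaScrewGrowthMomentsProofs
import Literature.NumberTheory.LFunctions.RiemannXiProofs
import Mathlib.Analysis.Calculus.IteratedDeriv.Defs
import Mathlib.Analysis.Calculus.ContDiff.Defs
import Mathlib.Analysis.Calculus.BumpFunction.Normed
import Mathlib.Analysis.Calculus.BumpFunction.InnerProduct
import Mathlib.Analysis.Calculus.Deriv.Polynomial
import Mathlib.Analysis.Calculus.ParametricIntegral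
import Mathlib.MeasureTheory.Integral.IntegralEqImproper
import Mathlib.MeasureTheory.Integral.ExpDecay
import Literature.Analysis.Complex.HolomorphicParametricIntegral
import HarnessLib

/-!
# Screw index transfer via Kreĭn definitizability — analytic core, part 1/5: objects, the six pieces, and the
# pieces (B′), (C), (E), (F) with the assembly `core_of_pieces`

rh-split-screw-bridge g5 (pub cell), CUT 1/5 of `ScrewIndexTransferKreinCore` (card `SPLIT-screw-bridge.md` §10-U⁗″;
lead RULING #43).  Objects: `IsTest`, `applyQ` (`Q(−i d/dx)` as the inline sum of the named fact
`Literature.Analysis.OperatorTheory.Stewart1972_thm_3_1`), `fC = −Ψ`, `KreinPos Q` (the fact's conclusion at `f = fC`),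
the translate form `transl`, the correlation `corr`, one- and two-sided Laplace transforms `lap`/`bilap`, `lapF`.
The six pieces `PieceA … PieceF` as `Prop`s; PROVED here: `pieceBp` (`Lap f = −w⁻² ξ′/ξ(½+w)` on `Re w > 1`, tree
`ZetaScrewLaplace`), `pieceC_holds` (order count at a pole of `ξ′/ξ`), `pieceF_holds` (count of the candidate set),
`pieceE_holds` (narrow bump with non-vanishing two-sided Laplace transform), and the assembly `core_of_pieces`.
Parts 2–5: `ScrewKreinCoreTranslates` (A), `ScrewKreinCoreSymbol` (D), `ScrewKreinCoreLaplace` (B, preliminaries),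
`ScrewIndexTransferKreinCore` (B, `core`, `indexTransferKrein`, `etail_iff_foz`).

HONEST LABEL.  `CofiniteCriticalLine` (all but finitely many nontrivial zeros on the line) is NOT RH, and
ETAIL (eventual positivity of the screw pivots) is NOT the screw criterion `∀ M, 0 < screwPivot M`; this module is
part of a chain relating the two tails to each other and decides neither.  Nothing here bears on the truth of RH.
-/

noncomputable section

set_option linter.dupNamespace false

namespace Summit.RiemannHypothesis.RiemannHypothesis.Theorems.Splittings.ScrewKreinCore

open Finset Complex MeasureTheory Set Filter Topology
open Literature.NumberTheory.LFunctions
open Literature.Analysis.OperatorTheory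
open Summit.RiemannHypothesis.RiemannHypothesis.Theses.RuelleBand
open Summit.RiemannHypothesis.RiemannHypothesis.Theorems.IntegerScrew

/-! ## Objects -/

/-- Test functions `C_c^∞(ℝ; ℂ)`. -/
def IsTest (φ : ℝ → ℂ) : Prop := ContDiff ℝ (⊤ : ℕ∞) φ ∧ HasCompactSupport φ

/-- `(Q(−i d/dx) φ)(x) = Σ_j Q_j (−i)^j φ^{(j)}(x)` (Stewart (4)), spelled as in the named fact. -/
def applyQ (Q : Polynomial ℂ) (φ : ℝ → ℂ) (x : ℝ) : ℂ :=
  ∑ j ∈ range (Q.natDegree + 1), Q.coeff j * (-Complex.I) ^ j * iteratedDeriv j φ x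

/-- `f = −Ψ` as a complex-valued function. -/
def fC : ℝ → ℂ := fun u => ((-zetaScrew u : ℝ) : ℂ)

/-- Stewart's positivity (4) for `f = −Ψ` and the polynomial `Q` (the conclusion of the Kreĭn fact). -/
def KreinPos (Q : Polynomial ℂ) : Prop :=
  ∀ φ : ℝ → ℂ, ContDiff ℝ (⊤ : ℕ∞) φ → HasCompactSupport φ →
    0 ≤ (∫ x : ℝ, ∫ y : ℝ, fC (x - y) * applyQ Q φ x * (starRingEnd ℂ) (applyQ Q φ y)).re

/-- The translate form `F_φ(s) = B(τ_s φ, φ) = ∬ f(x+s−y)(Qφ)(x) conj((Qφ)(y)) dx dy = (f ∗ c_φ)(s)`. -/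
def transl (Q : Polynomial ℂ) (φ : ℝ → ℂ) (s : ℝ) : ℂ :=
  ∫ x : ℝ, ∫ y : ℝ, fC (x + s - y) * applyQ Q φ x * (starRingEnd ℂ) (applyQ Q φ y)

/-- The correlation `c_φ(u) = ∫ (Qφ)(x) conj((Qφ)(x+u)) dx` (a test function). -/
def corr (Q : Polynomial ℂ) (φ : ℝ → ℂ) (u : ℝ) : ℂ :=
  ∫ x : ℝ, applyQ Q φ x * (starRingEnd ℂ) (applyQ Q φ (x + u))

/-- One-sided Laplace transform `∫₀^∞ g(s) e^{−ws} ds`. -/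
def lap (g : ℝ → ℂ) (w : ℂ) : ℂ := ∫ s in Ioi (0 : ℝ), g s * cexp (-(w * s))

/-- Two-sided Laplace transform `∫ g(u) e^{−wu} du` (for compactly supported `g`; `ĝ(w)`). -/
def bilap (g : ℝ → ℂ) (w : ℂ) : ℂ := ∫ u : ℝ, g u * cexp (-(w * u))

/-- `−w^{-2} (ξ'/ξ)(½ + w)`, the Laplace transform of `f = −Ψ` (`pieceBp`). -/
def lapF (w : ℂ) : ℂ := -(1 / w ^ 2 * logDeriv riemannXi (1 / 2 + w))

/-! ## The six pieces (hypotheses for the successor; `pieceBp` is proved) -/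

/-- (A) positivity ⟹ continuity and boundedness of the translate form. -/
def PieceA : Prop :=
  ∀ (Q : Polynomial ℂ) (φ : ℝ → ℂ), KreinPos Q → IsTest φ →
    Continuous (transl Q φ) ∧ ∃ C : ℝ, ∀ s : ℝ, ‖transl Q φ s‖ ≤ C

/-- (B) Laplace transform of the bounded continuous `F_φ = f ∗ c_φ`: holomorphic on `Re w > 0`, and
`= ĉ_φ · Lap f + (entire)` on `Re w > 1`. -/
def PieceB : Prop :=
  ∀ (Q : Polynomial ℂ) (φ : ℝ → ℂ), IsTest φ →
    (Continuous (transl Q φ) ∧ ∃ C : ℝ, ∀ s : ℝ, ‖transl Q φ s‖ ≤ C) →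
    DifferentiableOn ℂ (lap (transl Q φ)) {w : ℂ | 0 < w.re} ∧
      ∃ H : ℂ → ℂ, Differentiable ℂ H ∧
        ∀ w : ℂ, 1 < w.re → lap (transl Q φ) w = bilap (corr Q φ) w * lap fC w + H w

/-- (C) pole bookkeeping with a multiplier (cf. `ZetaScrewGrowth.riemannXi_ne_zero_of_laplace`). -/
def PieceC : Prop :=
  ∀ (G H c : ℂ → ℂ), DifferentiableOn ℂ G {w : ℂ | 0 < w.re} → Differentiable ℂ H → Differentiable ℂ c →
    (∀ w : ℂ, 1 < w.re → G w = c w * lapF w + H w) →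
    ∀ w₀ : ℂ, 0 < w₀.re → riemannXi (1 / 2 + w₀) = 0 → c w₀ = 0

/-- (D) the symbol of the correlation: `ĉ_φ(w) = Q(iw) Q̄(iw) φ̂(−w) conj(φ̂(w̄))`, an entire function. -/
def PieceD : Prop :=
  ∀ (Q : Polynomial ℂ) (φ : ℝ → ℂ), IsTest φ →
    Differentiable ℂ (bilap (corr Q φ)) ∧
      ∀ w : ℂ, bilap (corr Q φ) w =
        Q.eval (I * w) * (starRingEnd ℂ) (Q.eval ((starRingEnd ℂ) (I * w))) *
          bilap φ (-w) * (starRingEnd ℂ) (bilap φ ((starRingEnd ℂ) w))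

/-- (E) bump choice: a test function whose transform does not vanish at two prescribed points. -/
def PieceE : Prop :=
  ∀ a : ℂ, ∃ φ : ℝ → ℂ, IsTest φ ∧ bilap φ (-a) ≠ 0 ∧ bilap φ ((starRingEnd ℂ) a) ≠ 0

/-- (F) the count: zeros of `ξ(½ + ·)` in `Re > 0` confined to `Q(iw) Q̄(iw) = 0` ⟹ FOZ. -/
def PieceF : Prop :=
  ∀ Q : Polynomial ℂ, Q ≠ 0 →
    (∀ w₀ : ℂ, 0 < w₀.re → riemannXi (1 / 2 + w₀) = 0 →
      Q.eval (I * w₀) = 0 ∨ Q.eval ((starRingEnd ℂ) (I * w₀)) = 0) →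
    CofiniteCriticalLine

/-! ## Proved: the Laplace transform of `f = −Ψ` (tree) -/

/-- `Lap f(w) = −w^{-2}(ξ'/ξ)(½+w)` for `Re w > 1` (indeed `> ½`), from
`ZetaScrewLaplace.integral_zetaScrew_mul_cexp` with `a = −w`. [cite: Suzuki2023, Thm 1.1 (1)] -/
theorem pieceBp {w : ℂ} (hw : 1 < w.re) : lap fC w = lapF w := by
  have ha : (-w).re < -1 / 2 := by simp; linarith
  obtain ⟨hint, hval⟩ := ZetaScrewLaplace.integral_zetaScrew_mul_cexp ha
  have e : ∀ s : ℝ, fC s * cexp (-(w * s)) = -((zetaScrew s : ℂ) * cexp (-w * s)) := fun s => by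
    simp only [fC, ofReal_neg, neg_mul]
  simp only [lap, lapF, e, integral_neg, hval]
  congr 2
  · rw [neg_sq]
  · congr 1; ring

/-! ## The assembly -/

/-- **Analytic core from the six pieces** (kernel-checked glue; card §10-U⁗ U2′). [new-combination] -/
theorem core_of_pieces (hA : PieceA) (hB : PieceB) (hC : PieceC) (hD : PieceD) (hE : PieceE)
    (hF : PieceF) : ∀ Q : Polynomial ℂ, Q ≠ 0 → KreinPos Q → CofiniteCriticalLine := by
  intro Q hQ0 hpos
  refine hF Q hQ0 fun w₀ hw₀ hξ => ?_
  obtain ⟨φ, hφ, h1φ, h2φ⟩ := hE w₀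
  obtain ⟨hcont, C, hCb⟩ := hA Q φ hpos hφ
  obtain ⟨hGan, H, hH, hid⟩ := hB Q φ hφ ⟨hcont, C, hCb⟩
  obtain ⟨hcan, hsym⟩ := hD Q φ hφ
  have hid' : ∀ w : ℂ, 1 < w.re → lap (transl Q φ) w = bilap (corr Q φ) w * lapF w + H w := by
    intro w hw; rw [hid w hw, pieceBp hw]
  have hc0 := hC (lap (transl Q φ)) H (bilap (corr Q φ)) hGan hH hcan hid' w₀ hw₀ hξ
  rw [hsym w₀] at hc0
  rcases mul_eq_zero.mp hc0 with h | h
  · rcases mul_eq_zero.mp h with h | h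
    · rcases mul_eq_zero.mp h with h | h
      · exact Or.inl h
      · exact Or.inr ((map_eq_zero (starRingEnd ℂ)).mp h)
    · exact absurd h h1φ
  · exact absurd ((map_eq_zero (starRingEnd ℂ)).mp h) h2φ


/-! ## Proved: (C) the pole bookkeeping and (F) the count -/

/-- **(C) holds**: the tree's order argument (`ZetaScrewGrowth.riemannXi_ne_zero_of_laplace`) with a
multiplier `c`. [new-combination] -/
theorem pieceC_holds : PieceC := by
  intro G H c hG hH hc hid w₀ hw₀ hzero
  by_contra hc0
  set ε : ℝ := w₀.re / 2 with hε_def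
  have hε : 0 < ε := by positivity
  set Hs : Set ℂ := {s : ℂ | ε < s.re} with hHs_def
  have hHo : IsOpen Hs := isOpen_lt continuous_const Complex.continuous_re
  have hHpre : IsPreconnected Hs := (convex_halfSpace_re_gt ε).isPreconnected
  have hHsub : Hs ⊆ {s : ℂ | 0 < s.re} := fun s hs => lt_trans hε hs
  set Z : ℂ → ℂ := fun s ↦ riemannXi (1 / 2 + s) with hZ_def
  have hZd : Differentiable ℂ Z := differentiable_riemannXi.comp (by fun_prop)
  have hZa : ∀ s, AnalyticAt ℂ Z s := fun s ↦ hZd.analyticAt s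
  have hderivZ : ∀ s, deriv Z s = deriv riemannXi (1 / 2 + s) := fun s ↦ by
    simp only [hZ_def]
    exact deriv_comp_const_add riemannXi (1 / 2) s
  -- the two sides: `L = c · Z'` and `R = (−s²(G − H)) · Z`
  set P : ℂ → ℂ := fun s ↦ -(s ^ 2) * (G s - H s) with hP_def
  have hPa : ∀ s ∈ Hs, AnalyticAt ℂ P s := by
    intro s hs
    have hGa : AnalyticAt ℂ G s :=
      (hG.analyticOnNhd (isOpen_lt continuous_const Complex.continuous_re)) s (hHsub hs)
    exact ((analyticAt_id.pow 2).neg).mul (hGa.sub (hH.analyticAt s))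
  have hLa : AnalyticOnNhd ℂ (fun s ↦ c s * deriv Z s) Hs := fun s _ ↦
    (hc.analyticAt s).mul (hZa s).deriv
  have hRa : AnalyticOnNhd ℂ (fun s ↦ P s * Z s) Hs := fun s hs ↦ (hPa s hs).mul (hZa s)
  -- agreement on `Re s > 1`
  set s₀ : ℂ := ((w₀.re + 2 : ℝ) : ℂ) with hs₀_def
  have hs₀H : s₀ ∈ Hs := by
    simp only [hHs_def, Set.mem_setOf_eq, hs₀_def, ofReal_re, hε_def]; linarith
  have hev : (fun s ↦ c s * deriv Z s) =ᶠ[𝓝 s₀] (fun s ↦ P s * Z s) := by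
    have hopen : IsOpen {s : ℂ | 1 < s.re} := isOpen_lt continuous_const Complex.continuous_re
    have hs₀1 : s₀ ∈ {s : ℂ | 1 < s.re} := by
      simp only [Set.mem_setOf_eq, hs₀_def, ofReal_re]; linarith
    filter_upwards [hopen.mem_nhds hs₀1] with u hu
    have hu' : 1 < u.re := hu
    have hξ : riemannXi (1 / 2 + u) ≠ 0 := riemannXi_ne_zero_of_one_le_re (by simp; linarith)
    have hu0 : u ≠ 0 := fun h ↦ by rw [h, zero_re] at hu'; linarith
    have hGu := hid u hu'
    rw [hderivZ u]
    simp only [hP_def, hZ_def]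
    simp only [lapF, logDeriv_apply] at hGu
    rw [hGu]
    set A : ℂ := deriv riemannXi (1 / 2 + u) with hA
    set B : ℂ := riemannXi (1 / 2 + u) with hB
    field_simp
    ring
  have hEqOn : EqOn (fun s ↦ c s * deriv Z s) (fun s ↦ P s * Z s) Hs :=
    hLa.eqOn_of_preconnected_of_eventuallyEq hRa hHpre hs₀H hev
  have hw₀H : w₀ ∈ Hs := by
    simp only [hHs_def, Set.mem_setOf_eq, hε_def]; linarith
  have hevw : (fun s ↦ c s * deriv Z s) =ᶠ[𝓝 w₀] (fun s ↦ P s * Z s) := by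
    filter_upwards [hHo.mem_nhds hw₀H] with s hs using hEqOn hs
  -- orders at `w₀`
  have hZ0 : Z w₀ = 0 := hzero
  have h1 : analyticOrderAt (deriv Z) w₀ + 1 = analyticOrderAt Z w₀ := by
    have := (hZa w₀).analyticOrderAt_deriv_add_one
    simpa [hZ0] using this
  have hc_ord : analyticOrderAt c w₀ = 0 := (hc.analyticAt w₀).analyticOrderAt_eq_zero.mpr hc0
  have h2 : analyticOrderAt (fun s ↦ c s * deriv Z s) w₀ = analyticOrderAt (deriv Z) w₀ := by
    have := analyticOrderAt_mul (hc.analyticAt w₀) (hZa w₀).deriv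
    rw [hc_ord, zero_add] at this
    exact this
  have h3 : analyticOrderAt (fun s ↦ P s * Z s) w₀ = analyticOrderAt P w₀ + analyticOrderAt Z w₀ :=
    analyticOrderAt_mul (hPa w₀ hw₀H) (hZa w₀)
  have h4 : analyticOrderAt (deriv Z) w₀ = analyticOrderAt P w₀ + analyticOrderAt Z w₀ := by
    rw [← h2, analyticOrderAt_congr hevw, h3]
  rw [h4] at h1
  generalize hoZ : analyticOrderAt Z w₀ = oZ at h1
  generalize hoP : analyticOrderAt P w₀ = oP at h1
  cases oZ with
  | top =>
    have hloc : ∀ᶠ s in 𝓝 w₀, Z s = 0 := analyticOrderAt_eq_top.1 hoZ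
    have hall : EqOn Z 0 univ :=
      (hZd.differentiableOn.analyticOnNhd isOpen_univ).eqOn_zero_of_preconnected_of_eventuallyEq_zero
        isPreconnected_univ (Set.mem_univ w₀) hloc
    have h1' : Z 1 = 0 := hall (Set.mem_univ 1)
    simp only [hZ_def] at h1'
    exact riemannXi_ne_zero_of_one_le_re (s := 1 / 2 + 1) (by norm_num) h1'
  | coe n =>
    cases oP with
    | top => simp at h1
    | coe m =>
      have h' : (m + n + 1 : ℕ) = n := by exact_mod_cast h1
      omega

/-- **(F) holds**: the off-line zeros lie in the finite set `{½ − iλ, ½ − i conj λ : Q(λ) = 0}` and its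
reflection under `s ↦ 1 − s`. [new-combination] -/
theorem pieceF_holds : PieceF := by
  intro Q hQ0 hz
  classical
  set R : Finset ℂ := Q.roots.toFinset with hR
  set g₁ : ℂ → ℂ := fun l => 1 / 2 + -I * l with hg₁
  set g₂ : ℂ → ℂ := fun l => 1 / 2 + -I * (starRingEnd ℂ) l with hg₂
  set Sp : Set ℂ := g₁ '' (R : Set ℂ) ∪ g₂ '' (R : Set ℂ) with hSp_def
  have hSp : Sp.Finite := (R.finite_toSet.image g₁).union (R.finite_toSet.image g₂)
  have hmemR : ∀ l : ℂ, Q.eval l = 0 → l ∈ (R : Set ℂ) := by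
    intro l hl
    simp only [hR, Finset.mem_coe, Multiset.mem_toFinset, Polynomial.mem_roots hQ0, Polynomial.IsRoot.def, hl]
  have key : ∀ s : ℂ, riemannZeta s = 0 → 0 < s.re → s.re < 1 → 1 / 2 < s.re → s ∈ Sp := by
    intro s h0 h1 h2 h3
    have hξ : riemannXi (1 / 2 + (s - 1 / 2)) = 0 := by
      rw [show (1 / 2 : ℂ) + (s - 1 / 2) = s by ring]
      exact (riemannXi_eq_zero_iff_holds s).2 ⟨h0, h1, h2⟩
    have hw : 0 < (s - 1 / 2).re := by simp; linarith
    have hII : -I * (I * (s - 1 / 2)) = s - 1 / 2 := by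
      rw [← mul_assoc, neg_mul, I_mul_I, neg_neg, one_mul]
    rcases hz _ hw hξ with h | h
    · refine Or.inl ⟨I * (s - 1 / 2), hmemR _ h, ?_⟩
      simp only [hg₁, hII]; ring
    · refine Or.inr ⟨(starRingEnd ℂ) (I * (s - 1 / 2)), hmemR _ h, ?_⟩
      simp only [hg₂, Complex.conj_conj, hII]; ring
  refine (hSp.union (hSp.image fun z => 1 - z)).subset ?_
  rintro s ⟨h0, h1, h2, h3⟩
  rcases lt_or_gt_of_ne h3 with hlt | hgt
  · right
    have hξ : riemannXi (1 - s) = 0 := by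
      rw [riemannXi_one_sub]; exact (riemannXi_eq_zero_iff_holds s).2 ⟨h0, h1, h2⟩
    obtain ⟨h0', h1', h2'⟩ := (riemannXi_eq_zero_iff_holds (1 - s)).1 hξ
    refine ⟨1 - s, key (1 - s) h0' h1' h2' ?_, by ring⟩
    simp; linarith
  · exact Or.inl (key s h0 h1 h2 hgt)


/-! ## Proved: (E) the bump choice -/

/-- A narrow bump has a non-vanishing two-sided Laplace transform at a prescribed point: for
`b` a `ContDiffBump 0` with `‖v‖ · rOut ≤ 1/4`, `‖∫ b e^{−v x} − ∫ b‖ ≤ ½ ∫ b`. [folklore] -/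
theorem bilap_bump_ne_zero (b : ContDiffBump (0 : ℝ)) {v : ℂ} (hv : ‖v‖ * b.rOut ≤ 1 / 4) :
    bilap (fun x => ((b x : ℝ) : ℂ)) v ≠ 0 := by
  have hcont : Continuous fun x : ℝ => ((b x : ℝ) : ℂ) := continuous_ofReal.comp b.continuous
  have hsupp : HasCompactSupport fun x : ℝ => ((b x : ℝ) : ℂ) :=
    b.hasCompactSupport.comp_left (g := fun r : ℝ => (r : ℂ)) ofReal_zero
  have hint1 : Integrable fun x : ℝ => ((b x : ℝ) : ℂ) * cexp (-(v * x)) :=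
    (hcont.mul (by fun_prop)).integrable_of_hasCompactSupport hsupp.mul_right
  have hint0 : Integrable fun x : ℝ => ((b x : ℝ) : ℂ) := hcont.integrable_of_hasCompactSupport hsupp
  have hIpos : 0 < ∫ x, b x := b.integral_pos
  -- pointwise bound on the support
  have hpt : ∀ x : ℝ, ‖((b x : ℝ) : ℂ) * cexp (-(v * x)) - ((b x : ℝ) : ℂ)‖ ≤ b x * (1 / 2) := by
    intro x
    rw [← mul_sub_one, norm_mul, Complex.norm_real, Real.norm_of_nonneg b.nonneg]
    by_cases hx : b x = 0
    · simp [hx]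
    · have hxs : x ∈ Function.support (b : ℝ → ℝ) := hx
      rw [b.support_eq, Metric.mem_ball, dist_zero_right] at hxs
      have hz : ‖-(v * (x : ℂ))‖ ≤ 1 / 4 := by
        rw [norm_neg, norm_mul, Complex.norm_real]
        calc ‖v‖ * ‖x‖ ≤ ‖v‖ * b.rOut := by
              exact mul_le_mul_of_nonneg_left (le_of_lt hxs) (norm_nonneg _)
          _ ≤ 1 / 4 := hv
      refine mul_le_mul_of_nonneg_left ?_ b.nonneg
      calc ‖cexp (-(v * x)) - 1‖ ≤ 2 * ‖-(v * (x : ℂ))‖ := Complex.norm_exp_sub_one_le (by linarith)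
        _ ≤ 1 / 2 := by linarith
  have hdiff : ‖bilap (fun x => ((b x : ℝ) : ℂ)) v - ∫ x, ((b x : ℝ) : ℂ)‖ ≤ (∫ x, b x) * (1 / 2) := by
    rw [bilap, ← integral_sub hint1 hint0]
    calc ‖∫ x, (((b x : ℝ) : ℂ) * cexp (-(v * x)) - ((b x : ℝ) : ℂ))‖
        ≤ ∫ x, ‖((b x : ℝ) : ℂ) * cexp (-(v * x)) - ((b x : ℝ) : ℂ)‖ := norm_integral_le_integral_norm _
      _ ≤ ∫ x, b x * (1 / 2) := by
          refine integral_mono_of_nonneg (Eventually.of_forall fun x => norm_nonneg _)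
            (b.integrable.mul_const _) (Eventually.of_forall hpt)
      _ = (∫ x, b x) * (1 / 2) := integral_mul_const _ _
  have hI : (∫ x, ((b x : ℝ) : ℂ)) = ((∫ x, b x : ℝ) : ℂ) := integral_ofReal
  intro h0
  rw [h0, zero_sub, norm_neg, hI, Complex.norm_real, Real.norm_of_nonneg hIpos.le] at hdiff
  linarith

/-- **(E) holds.** [folklore] -/
theorem pieceE_holds : PieceE := by
  intro a
  -- a bump of radius `r = 1 / (4(‖a‖ + 1))` about `0`
  set r : ℝ := 1 / (4 * (‖a‖ + 1)) with hr
  have hr0 : 0 < r := by positivity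
  let b : ContDiffBump (0 : ℝ) := ⟨r / 2, r, by positivity, by linarith⟩
  have hbr : b.rOut = r := rfl
  have hva : ‖a‖ * r ≤ 1 / 4 := by
    rw [hr, ← mul_div_assoc, mul_one, div_le_div_iff₀ (by positivity) (by norm_num)]
    nlinarith [norm_nonneg a]
  refine ⟨fun x => ((b x : ℝ) : ℂ), ⟨?_, ?_⟩, ?_, ?_⟩
  · exact ofRealCLM.contDiff.comp b.contDiff
  · exact b.hasCompactSupport.comp_left (g := fun r : ℝ => (r : ℂ)) ofReal_zero
  · exact bilap_bump_ne_zero b (by rwa [norm_neg, hbr])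
  · exact bilap_bump_ne_zero b (by rwa [Complex.norm_conj, hbr])

end Summit.RiemannHypothesis.RiemannHypothesis.Theorems.Splittings.ScrewKreinCore

end
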